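import Mathlib
import HarnessLib
import Summits.Ventures.LatticeQCDFlow.Exactness.SU2MaskedKickLayer
import Summits.Ventures.LatticeQCDFlow.Exactness.GaugeFTHMCCreutz
import Summits.Ventures.LatticeQCDFlow.Exactness.NCPLayerEquiv

/-!
# Schedules of masked `SU(2)` kick layers: the member as a list of certified layers; FT-HMC through it is exact, reversible, and satisfies `⟨e^{−ΔH̃}⟩ = 1`

HONEST FRAMING: exact (Metropolis-corrected) sampling algorithms for lattice gauge theory;
figures of merit are autocorrelation/cost numbers at stated couplings and volumes; no
continuum-physics claim.

Venture `LatticeQCDFlow` (cell pub-lqcd), topic `Exactness`; FANOUT row 14 (`eng-flowhmc`, engine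
`latflow.fthmc`, family B).  NEW WORK of the cell; nothing is cited as a fact; no number.
Continuation of `SU2MaskedKickLayer.lean` (one layer) to MEMBERS: the engine composes a map from a
schedule of masked sub-steps (`lax.scan` over `(μ, phase, per-layer weights)`), booking the
running sum of per-layer log-dets.  Layer specs `s : σ` carry a mask `P s`, a step constant
`εf s` and a frozen measurable local field `Jf s` inside its refusal rule `|εf s| ‖Jf s V e‖ < 1`.

* **`su2_fthmc_leapfrog_gaussian_creutz_maskedKick`** — through ONE masked kick layer, started in
  equilibrium, `⟨e^{−ΔH̃}⟩ = 1` exactly (Creutz's identity, `gauge_fthmc_leapfrog_gaussian_creutz`;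
  `e^{−S}` integrable, e.g. any action bounded below);
* **`exists_layers_su2MaskedKick`** — any schedule `sched : List σ` is a list of certified layers
  (measurable equivalences of `GaugeConfig d L SU(2)` with positive measurable Haar Jacobians)
  whose forward maps and densities ARE the masked kicks and the booked per-layer factors;
* **`su2_fthmc_leapfrog_gaussian_exact_maskedKickSchedule`** — FT-HMC as the engine runs it on
  the `SU(2)` rung (Gaussian momenta `(Edge × Fin 3) → ℝ`, closed-form quaternion exponential
  drift, ANY measurable force, any trajectory length, flip, Metropolis on the pulled-back
  Hamiltonian with the running log-det, report through the member) leaves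
  `e^{−S} · ⊗_e haarProbability SU(2)` invariant (`hasJacobian_foldr_trans` +
  `gauge_fthmc_leapfrog_config_exact`);
* **`su2_fthmc_leapfrog_gaussian_isReversible_maskedKickSchedule`** — detailed balance;
* **`su2_fthmc_leapfrog_gaussian_creutz_maskedKickSchedule`** — `⟨e^{−ΔH̃}⟩ = 1` in
  equilibrium (`gauge_fthmc_leapfrog_gaussian_creutz`).

The LO Wilson-flow member (`SU2WilsonFlowLOSchedule.lean`) and the learned residual member
(`SU2ResidualLayer.lean`) are instances.

NOT CLAIMED: anything about the networks producing the fields; `SU(N ≥ 3)`; ergodicity; any number.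
-/

noncomputable section

namespace Summit.Ventures.LatticeQCDFlow.Exactness

open Real Set MeasureTheory Measure InnerProductGeometry Metric WithLp
open Literature.MathematicalPhysics.QuantumFieldTheory Summit.Ventures.LatticeQCDFlow.Theory2
open ProbabilityTheory ProbabilityTheory.Kernel
open Literature.Probability.MarkovChains.HMC (boltzmann)
open scoped ENNReal Matrix

/-! ## `⟨e^{−ΔH̃}⟩ = 1` through one masked kick layer -/

section Member

variable {d L : ℕ} [NeZero L] (p : Edge d L → Prop) [DecidablePred p]

/-- **FT-HMC through a masked kick layer, started in equilibrium, has `⟨e^{−ΔH̃}⟩ = 1` exactly** (Creutz's identity through the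
certified layer; `e^{−S}` integrable, e.g. any action bounded below, `integrable_exp_neg_of_le`). -/
theorem su2_fthmc_leapfrog_gaussian_creutz_maskedKick {ε : ℝ}
    (J : GaugeConfig d L (Matrix.specialUnitaryGroup (Fin 2) ℂ) → Edge d L → R4)
    (hJm : ∀ e, p e → Measurable fun V : GaugeConfig d L (Matrix.specialUnitaryGroup (Fin 2) ℂ) => J V e)
    (hJloc : ∀ V W : GaugeConfig d L (Matrix.specialUnitaryGroup (Fin 2) ℂ),
      (∀ j, ¬p j → V j = W j) → ∀ e, p e → J V e = J W e)
    (hκ : ∀ (V : GaugeConfig d L (Matrix.specialUnitaryGroup (Fin 2) ℂ)) (e : Edge d L), p e → |ε| * ‖J V e‖ < 1)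
    {S : GaugeConfig d L (Matrix.specialUnitaryGroup (Fin 2) ℂ) → ℝ} (hS : Measurable S)
    (hSi : Integrable (fun V => Real.exp (-S V))
      (Measure.pi fun _ : Edge d L => haarProbability (Matrix.specialUnitaryGroup (Fin 2) ℂ)))
    (c : ℝ) {g : GaugeConfig d L (Matrix.specialUnitaryGroup (Fin 2) ℂ) → ((Edge d L × Fin 3) → ℝ)} (hg : Measurable g) (n : ℕ) :
    ∃ F : GaugeConfig d L (Matrix.specialUnitaryGroup (Fin 2) ℂ) ≃ᵐ GaugeConfig d L (Matrix.specialUnitaryGroup (Fin 2) ℂ),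
      (⇑F = fun (V : GaugeConfig d L (Matrix.specialUnitaryGroup (Fin 2) ℂ)) (e : Edge d L) =>
        if p e then gaussUnit (geodesicKick ε (J V e)
          (vecQuat ((V e : Matrix.specialUnitaryGroup (Fin 2) ℂ) : Matrix (Fin 2) (Fin 2) ℂ)))
        else V e) ∧
      ∫ z, Real.exp (-(((S (F ((((flip : Equiv.Perm (GaugeConfig d L (Matrix.specialUnitaryGroup (Fin 2) ℂ) × ((Edge d L × Fin 3) → ℝ))) *
              leapfrog (mulDrift (fun q : ((Edge d L × Fin 3) → ℝ) => fun ℓ : Edge d L => gaussUnit (toLp 2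
          ![Real.cos (c * Real.sqrt (q (ℓ, 0) ^ 2 + q (ℓ, 1) ^ 2 + q (ℓ, 2) ^ 2)),
            c * Real.sinc (c * Real.sqrt (q (ℓ, 0) ^ 2 + q (ℓ, 1) ^ 2 + q (ℓ, 2) ^ 2)) * q (ℓ, 0),
            c * Real.sinc (c * Real.sqrt (q (ℓ, 0) ^ 2 + q (ℓ, 1) ^ 2 + q (ℓ, 2) ^ 2)) * q (ℓ, 1),
            c * Real.sinc (c * Real.sqrt (q (ℓ, 0) ^ 2 + q (ℓ, 1) ^ 2 + q (ℓ, 2) ^ 2)) * q (ℓ, 2)]))) g ^ n)) z).1) -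
            Real.log ((fun V : GaugeConfig d L (Matrix.specialUnitaryGroup (Fin 2) ℂ) => ∏ a : {e : Edge d L // p e},
                  (if Real.sin (angle (J V a.1) (vecQuat ((V a.1 : Matrix.specialUnitaryGroup (Fin 2) ℂ) : Matrix (Fin 2) (Fin 2) ℂ))) = 0 then
                      (1 - ε * ‖J V a.1‖ * Real.cos (angle (J V a.1) (vecQuat ((V a.1 : Matrix.specialUnitaryGroup (Fin 2) ℂ) : Matrix (Fin 2) (Fin 2) ℂ)))) ^ 3
                    else kickJac (ε * ‖J V a.1‖) 2 (angle (J V a.1) (vecQuat ((V a.1 : Matrix.specialUnitaryGroup (Fin 2) ℂ) : Matrix (Fin 2) (Fin 2) ℂ)))))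
              ((((flip : Equiv.Perm (GaugeConfig d L (Matrix.specialUnitaryGroup (Fin 2) ℂ) × ((Edge d L × Fin 3) → ℝ))) *
              leapfrog (mulDrift (fun q : ((Edge d L × Fin 3) → ℝ) => fun ℓ : Edge d L => gaussUnit (toLp 2
          ![Real.cos (c * Real.sqrt (q (ℓ, 0) ^ 2 + q (ℓ, 1) ^ 2 + q (ℓ, 2) ^ 2)),
            c * Real.sinc (c * Real.sqrt (q (ℓ, 0) ^ 2 + q (ℓ, 1) ^ 2 + q (ℓ, 2) ^ 2)) * q (ℓ, 0),
            c * Real.sinc (c * Real.sqrt (q (ℓ, 0) ^ 2 + q (ℓ, 1) ^ 2 + q (ℓ, 2) ^ 2)) * q (ℓ, 1),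
            c * Real.sinc (c * Real.sqrt (q (ℓ, 0) ^ 2 + q (ℓ, 1) ^ 2 + q (ℓ, 2) ^ 2)) * q (ℓ, 2)]))) g ^ n)) z).1)) +
            ∑ i, ((((flip : Equiv.Perm (GaugeConfig d L (Matrix.specialUnitaryGroup (Fin 2) ℂ) × ((Edge d L × Fin 3) → ℝ))) *
              leapfrog (mulDrift (fun q : ((Edge d L × Fin 3) → ℝ) => fun ℓ : Edge d L => gaussUnit (toLp 2
          ![Real.cos (c * Real.sqrt (q (ℓ, 0) ^ 2 + q (ℓ, 1) ^ 2 + q (ℓ, 2) ^ 2)),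
            c * Real.sinc (c * Real.sqrt (q (ℓ, 0) ^ 2 + q (ℓ, 1) ^ 2 + q (ℓ, 2) ^ 2)) * q (ℓ, 0),
            c * Real.sinc (c * Real.sqrt (q (ℓ, 0) ^ 2 + q (ℓ, 1) ^ 2 + q (ℓ, 2) ^ 2)) * q (ℓ, 1),
            c * Real.sinc (c * Real.sqrt (q (ℓ, 0) ^ 2 + q (ℓ, 1) ^ 2 + q (ℓ, 2) ^ 2)) * q (ℓ, 2)]))) g ^ n)) z).2 i ^ 2 / 2) -
          ((S (F z.1) - Real.log ((fun V : GaugeConfig d L (Matrix.specialUnitaryGroup (Fin 2) ℂ) => ∏ a : {e : Edge d L // p e},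
                  (if Real.sin (angle (J V a.1) (vecQuat ((V a.1 : Matrix.specialUnitaryGroup (Fin 2) ℂ) : Matrix (Fin 2) (Fin 2) ℂ))) = 0 then
                      (1 - ε * ‖J V a.1‖ * Real.cos (angle (J V a.1) (vecQuat ((V a.1 : Matrix.specialUnitaryGroup (Fin 2) ℂ) : Matrix (Fin 2) (Fin 2) ℂ)))) ^ 3
                    else kickJac (ε * ‖J V a.1‖) 2 (angle (J V a.1) (vecQuat ((V a.1 : Matrix.specialUnitaryGroup (Fin 2) ℂ) : Matrix (Fin 2) (Fin 2) ℂ))))) z.1)) + ∑ i, z.2 i ^ 2 / 2)))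
      ∂(boltzmann ((Measure.pi fun _ : Edge d L => haarProbability (Matrix.specialUnitaryGroup (Fin 2) ℂ)).prod
            (volume : Measure ((Edge d L × Fin 3) → ℝ)))
          fun z : GaugeConfig d L (Matrix.specialUnitaryGroup (Fin 2) ℂ) × ((Edge d L × Fin 3) → ℝ) =>
            (S (F z.1) - Real.log ((fun V : GaugeConfig d L (Matrix.specialUnitaryGroup (Fin 2) ℂ) => ∏ a : {e : Edge d L // p e},
                  (if Real.sin (angle (J V a.1) (vecQuat ((V a.1 : Matrix.specialUnitaryGroup (Fin 2) ℂ) : Matrix (Fin 2) (Fin 2) ℂ))) = 0 then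
                      (1 - ε * ‖J V a.1‖ * Real.cos (angle (J V a.1) (vecQuat ((V a.1 : Matrix.specialUnitaryGroup (Fin 2) ℂ) : Matrix (Fin 2) (Fin 2) ℂ)))) ^ 3
                    else kickJac (ε * ‖J V a.1‖) 2 (angle (J V a.1) (vecQuat ((V a.1 : Matrix.specialUnitaryGroup (Fin 2) ℂ) : Matrix (Fin 2) (Fin 2) ℂ))))) z.1)) + ∑ i, z.2 i ^ 2 / 2) = 1 := by
  obtain ⟨F, hF, hJ, hpos, hJm'⟩ := exists_measurableEquiv_su2MaskedKick p J hJm hJloc hκ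
  exact ⟨F, hF, gauge_fthmc_leapfrog_gaussian_creutz hpos hJm' hJ (measurable_su2Drift c) hg n hS hSi⟩

end Member

/-! ## Schedules of masked kick layers (the member = a list of certified layers) -/

section Schedule

variable {d L : ℕ} [NeZero L] {σ : Type*} (P : σ → Edge d L → Prop) [∀ s, DecidablePred (P s)]

/-- **Any schedule of masked `SU(2)` kick layers is a list of certified layers.**  Layer specs
`s : σ` carry a mask `P s`, a step constant `εf s` and a frozen measurable field `Jf s` inside the
refusal rule; the schedule `sched : List σ` (e.g. the engine's `(μ, phase, per-layer weights)`
scan) yields measurable equivalences with positive measurable certified Jacobians whose forward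
maps and densities ARE the masked kicks and the booked per-layer log-dets — ready for
`hasJacobian_foldr_trans` / `thmc_hmc_exact_foldr` / `gauge_fthmc_leapfrog_gaussian_creutz_layers`. -/
theorem exists_layers_su2MaskedKick (εf : σ → ℝ)
    (Jf : σ → GaugeConfig d L (Matrix.specialUnitaryGroup (Fin 2) ℂ) → Edge d L → R4)
    (hJm : ∀ s e, P s e → Measurable fun V : GaugeConfig d L (Matrix.specialUnitaryGroup (Fin 2) ℂ) => Jf s V e)
    (hJloc : ∀ s (V W : GaugeConfig d L (Matrix.specialUnitaryGroup (Fin 2) ℂ)),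
      (∀ j, ¬P s j → V j = W j) → ∀ e, P s e → Jf s V e = Jf s W e)
    (hκ : ∀ s (V : GaugeConfig d L (Matrix.specialUnitaryGroup (Fin 2) ℂ)) (e : Edge d L),
      P s e → |εf s| * ‖Jf s V e‖ < 1)
    (sched : List σ) :
    ∃ layers : List ((GaugeConfig d L (Matrix.specialUnitaryGroup (Fin 2) ℂ) ≃ᵐ GaugeConfig d L (Matrix.specialUnitaryGroup (Fin 2) ℂ)) × (GaugeConfig d L (Matrix.specialUnitaryGroup (Fin 2) ℂ) → ℝ)),
      layers.map (fun Ly => ((Ly.1 : GaugeConfig d L (Matrix.specialUnitaryGroup (Fin 2) ℂ) → GaugeConfig d L (Matrix.specialUnitaryGroup (Fin 2) ℂ)), Ly.2)) =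
        sched.map (fun s =>
          ((fun (V : GaugeConfig d L (Matrix.specialUnitaryGroup (Fin 2) ℂ)) (e : Edge d L) =>
            if P s e then gaussUnit (geodesicKick (εf s) (Jf s V e)
              (vecQuat ((V e : Matrix.specialUnitaryGroup (Fin 2) ℂ) : Matrix (Fin 2) (Fin 2) ℂ)))
            else V e),
           fun V : GaugeConfig d L (Matrix.specialUnitaryGroup (Fin 2) ℂ) => ∏ a : {e : Edge d L // P s e},
            (if Real.sin (angle (Jf s V a.1) (vecQuat ((V a.1 : Matrix.specialUnitaryGroup (Fin 2) ℂ) : Matrix (Fin 2) (Fin 2) ℂ))) = 0 then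
                (1 - εf s * ‖Jf s V a.1‖ * Real.cos (angle (Jf s V a.1) (vecQuat ((V a.1 : Matrix.specialUnitaryGroup (Fin 2) ℂ) : Matrix (Fin 2) (Fin 2) ℂ)))) ^ 3
              else kickJac (εf s * ‖Jf s V a.1‖) 2 (angle (Jf s V a.1) (vecQuat ((V a.1 : Matrix.specialUnitaryGroup (Fin 2) ℂ) : Matrix (Fin 2) (Fin 2) ℂ)))))) ∧
      (∀ Ly ∈ layers, ∀ V, 0 < Ly.2 V) ∧ (∀ Ly ∈ layers, Measurable Ly.2) ∧
      (∀ Ly ∈ layers, HasJacobian (Measure.pi fun _ : Edge d L => haarProbability (Matrix.specialUnitaryGroup (Fin 2) ℂ)) Ly.1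
        fun V => ENNReal.ofReal (Ly.2 V)) := by
  induction sched with
  | nil => exact ⟨[], by simp, by simp, by simp, by simp⟩
  | cons s rest ih =>
    obtain ⟨layers, hmap, hpos, hmeas, hjac⟩ := ih
    obtain ⟨F, hF, hJ, hFpos, hFmeas⟩ :=
      exists_measurableEquiv_su2MaskedKick (P s) (Jf s) (hJm s) (hJloc s) (hκ s)
    refine ⟨(F, fun V : GaugeConfig d L (Matrix.specialUnitaryGroup (Fin 2) ℂ) => ∏ a : {e : Edge d L // P s e},
            (if Real.sin (angle (Jf s V a.1) (vecQuat ((V a.1 : Matrix.specialUnitaryGroup (Fin 2) ℂ) : Matrix (Fin 2) (Fin 2) ℂ))) = 0 then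
                (1 - εf s * ‖Jf s V a.1‖ * Real.cos (angle (Jf s V a.1) (vecQuat ((V a.1 : Matrix.specialUnitaryGroup (Fin 2) ℂ) : Matrix (Fin 2) (Fin 2) ℂ)))) ^ 3
              else kickJac (εf s * ‖Jf s V a.1‖) 2 (angle (Jf s V a.1) (vecQuat ((V a.1 : Matrix.specialUnitaryGroup (Fin 2) ℂ) : Matrix (Fin 2) (Fin 2) ℂ))))) :: layers,
      ?_, ?_, ?_, ?_⟩
    · rw [List.map_cons, List.map_cons, hmap, hF]
    · intro Ly hLy
      rcases List.mem_cons.mp hLy with rfl | h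
      exacts [hFpos, hpos Ly h]
    · intro Ly hLy
      rcases List.mem_cons.mp hLy with rfl | h
      exacts [hFmeas, hmeas Ly h]
    · intro Ly hLy
      rcases List.mem_cons.mp hLy with rfl | h
      exacts [hJ, hjac Ly h]

/-- **FT-HMC as the engine runs it on the `SU(2)` rung, through a whole schedule of masked kick
layers (running log-det), is exact.** -/
theorem su2_fthmc_leapfrog_gaussian_exact_maskedKickSchedule (εf : σ → ℝ)
    (Jf : σ → GaugeConfig d L (Matrix.specialUnitaryGroup (Fin 2) ℂ) → Edge d L → R4)
    (hJm : ∀ s e, P s e → Measurable fun V : GaugeConfig d L (Matrix.specialUnitaryGroup (Fin 2) ℂ) => Jf s V e)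
    (hJloc : ∀ s (V W : GaugeConfig d L (Matrix.specialUnitaryGroup (Fin 2) ℂ)),
      (∀ j, ¬P s j → V j = W j) → ∀ e, P s e → Jf s V e = Jf s W e)
    (hκ : ∀ s (V : GaugeConfig d L (Matrix.specialUnitaryGroup (Fin 2) ℂ)) (e : Edge d L),
      P s e → |εf s| * ‖Jf s V e‖ < 1)
    (sched : List σ)
    {S : GaugeConfig d L (Matrix.specialUnitaryGroup (Fin 2) ℂ) → ℝ} (hS : Measurable S) (c : ℝ)
    {g : GaugeConfig d L (Matrix.specialUnitaryGroup (Fin 2) ℂ) → ((Edge d L × Fin 3) → ℝ)} (hg : Measurable g) (n : ℕ) :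
    ∃ layers : List ((GaugeConfig d L (Matrix.specialUnitaryGroup (Fin 2) ℂ) ≃ᵐ GaugeConfig d L (Matrix.specialUnitaryGroup (Fin 2) ℂ)) × (GaugeConfig d L (Matrix.specialUnitaryGroup (Fin 2) ℂ) → ℝ)),
      layers.map (fun Ly => ((Ly.1 : GaugeConfig d L (Matrix.specialUnitaryGroup (Fin 2) ℂ) → GaugeConfig d L (Matrix.specialUnitaryGroup (Fin 2) ℂ)), Ly.2)) =
        sched.map (fun s =>
          ((fun (V : GaugeConfig d L (Matrix.specialUnitaryGroup (Fin 2) ℂ)) (e : Edge d L) =>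
            if P s e then gaussUnit (geodesicKick (εf s) (Jf s V e)
              (vecQuat ((V e : Matrix.specialUnitaryGroup (Fin 2) ℂ) : Matrix (Fin 2) (Fin 2) ℂ)))
            else V e),
           fun V : GaugeConfig d L (Matrix.specialUnitaryGroup (Fin 2) ℂ) => ∏ a : {e : Edge d L // P s e},
            (if Real.sin (angle (Jf s V a.1) (vecQuat ((V a.1 : Matrix.specialUnitaryGroup (Fin 2) ℂ) : Matrix (Fin 2) (Fin 2) ℂ))) = 0 then
                (1 - εf s * ‖Jf s V a.1‖ * Real.cos (angle (Jf s V a.1) (vecQuat ((V a.1 : Matrix.specialUnitaryGroup (Fin 2) ℂ) : Matrix (Fin 2) (Fin 2) ℂ)))) ^ 3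
              else kickJac (εf s * ‖Jf s V a.1‖) 2 (angle (Jf s V a.1) (vecQuat ((V a.1 : Matrix.specialUnitaryGroup (Fin 2) ℂ) : Matrix (Fin 2) (Fin 2) ℂ)))))) ∧
      Invariant
        (conjKernel
          (refreshUpdate
            (involMH
              (⇑((flip : Equiv.Perm (GaugeConfig d L (Matrix.specialUnitaryGroup (Fin 2) ℂ) × ((Edge d L × Fin 3) → ℝ))) *
                  leapfrog (mulDrift fun q : (Edge d L × Fin 3) → ℝ =>
                    fun ℓ : Edge d L => gaussUnit (toLp 2
          ![Real.cos (c * Real.sqrt (q (ℓ, 0) ^ 2 + q (ℓ, 1) ^ 2 + q (ℓ, 2) ^ 2)),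
            c * Real.sinc (c * Real.sqrt (q (ℓ, 0) ^ 2 + q (ℓ, 1) ^ 2 + q (ℓ, 2) ^ 2)) * q (ℓ, 0),
            c * Real.sinc (c * Real.sqrt (q (ℓ, 0) ^ 2 + q (ℓ, 1) ^ 2 + q (ℓ, 2) ^ 2)) * q (ℓ, 1),
            c * Real.sinc (c * Real.sqrt (q (ℓ, 0) ^ 2 + q (ℓ, 1) ^ 2 + q (ℓ, 2) ^ 2)) * q (ℓ, 2)])) g ^ n))
              (measurable_flip_leapfrog_pow (measurable_mulDrift (measurable_su2Drift c)) hg n)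
              fun z : GaugeConfig d L (Matrix.specialUnitaryGroup (Fin 2) ℂ) × ((Edge d L × Fin 3) → ℝ) =>
                (S ((layers.foldr (fun Ly (G : GaugeConfig d L (Matrix.specialUnitaryGroup (Fin 2) ℂ) ≃ᵐ GaugeConfig d L (Matrix.specialUnitaryGroup (Fin 2) ℂ)) => Ly.1.trans G)
              (MeasurableEquiv.refl (GaugeConfig d L (Matrix.specialUnitaryGroup (Fin 2) ℂ)))) z.1) - Real.log ((layers.foldr (fun Ly K => fun V => Ly.2 V * K (Ly.1 V)) (fun _ => (1 : ℝ))) z.1)) + ∑ i, z.2 i ^ 2 / 2)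
            ((((volume : Measure ((Edge d L × Fin 3) → ℝ)).withDensity
                  fun q => ENNReal.ofReal (Real.exp (-(∑ i, q i ^ 2 / 2)))) Set.univ)⁻¹ •
              (volume : Measure ((Edge d L × Fin 3) → ℝ)).withDensity
                fun q => ENNReal.ofReal (Real.exp (-(∑ i, q i ^ 2 / 2)))))
          (layers.foldr (fun Ly (G : GaugeConfig d L (Matrix.specialUnitaryGroup (Fin 2) ℂ) ≃ᵐ GaugeConfig d L (Matrix.specialUnitaryGroup (Fin 2) ℂ)) => Ly.1.trans G)
              (MeasurableEquiv.refl (GaugeConfig d L (Matrix.specialUnitaryGroup (Fin 2) ℂ)))))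
        ((Measure.pi fun _ : Edge d L => haarProbability (Matrix.specialUnitaryGroup (Fin 2) ℂ)).withDensity
          fun U => ENNReal.ofReal (Real.exp (-S U))) := by
  obtain ⟨layers, hmap, hpos, hmeas, hjac⟩ := exists_layers_su2MaskedKick P εf Jf hJm hJloc hκ sched
  obtain ⟨h0, hm, hJ⟩ := hasJacobian_foldr_trans layers hpos hmeas hjac
  haveI := isNegInvariant_volume_pi (Λ := Edge d L × Fin 3)
  refine ⟨layers, hmap, ?_⟩
  exact gauge_fthmc_leapfrog_config_exact
    (μ := Measure.pi fun _ : Edge d L => haarProbability (Matrix.specialUnitaryGroup (Fin 2) ℂ))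
    (ν := (volume : Measure ((Edge d L × Fin 3) → ℝ)))
    (F := (layers.foldr (fun Ly (G : GaugeConfig d L (Matrix.specialUnitaryGroup (Fin 2) ℂ) ≃ᵐ GaugeConfig d L (Matrix.specialUnitaryGroup (Fin 2) ℂ)) => Ly.1.trans G)
              (MeasurableEquiv.refl (GaugeConfig d L (Matrix.specialUnitaryGroup (Fin 2) ℂ)))))
    (J := (layers.foldr (fun Ly K => fun V => Ly.2 V * K (Ly.1 V)) (fun _ => (1 : ℝ))))
    (e := fun q : (Edge d L × Fin 3) → ℝ => fun ℓ : Edge d L => gaussUnit (toLp 2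
          ![Real.cos (c * Real.sqrt (q (ℓ, 0) ^ 2 + q (ℓ, 1) ^ 2 + q (ℓ, 2) ^ 2)),
            c * Real.sinc (c * Real.sqrt (q (ℓ, 0) ^ 2 + q (ℓ, 1) ^ 2 + q (ℓ, 2) ^ 2)) * q (ℓ, 0),
            c * Real.sinc (c * Real.sqrt (q (ℓ, 0) ^ 2 + q (ℓ, 1) ^ 2 + q (ℓ, 2) ^ 2)) * q (ℓ, 1),
            c * Real.sinc (c * Real.sqrt (q (ℓ, 0) ^ 2 + q (ℓ, 1) ^ 2 + q (ℓ, 2) ^ 2)) * q (ℓ, 2)]))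
    (g := g) (S := S) (T := fun q : (Edge d L × Fin 3) → ℝ => ∑ i, q i ^ 2 / 2)
    h0 hm hJ (fun q => su2Drift_neg c q) (measurable_su2Drift c) hg n hS
    measurable_piGaussianKinetic piGaussianWeight_univ_ne_zero_ne_top.1
    piGaussianWeight_univ_ne_zero_ne_top.2

/-- **… satisfies detailed balance …** -/
theorem su2_fthmc_leapfrog_gaussian_isReversible_maskedKickSchedule (εf : σ → ℝ)
    (Jf : σ → GaugeConfig d L (Matrix.specialUnitaryGroup (Fin 2) ℂ) → Edge d L → R4)
    (hJm : ∀ s e, P s e → Measurable fun V : GaugeConfig d L (Matrix.specialUnitaryGroup (Fin 2) ℂ) => Jf s V e)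
    (hJloc : ∀ s (V W : GaugeConfig d L (Matrix.specialUnitaryGroup (Fin 2) ℂ)),
      (∀ j, ¬P s j → V j = W j) → ∀ e, P s e → Jf s V e = Jf s W e)
    (hκ : ∀ s (V : GaugeConfig d L (Matrix.specialUnitaryGroup (Fin 2) ℂ)) (e : Edge d L),
      P s e → |εf s| * ‖Jf s V e‖ < 1)
    (sched : List σ)
    {S : GaugeConfig d L (Matrix.specialUnitaryGroup (Fin 2) ℂ) → ℝ} (hS : Measurable S) (c : ℝ)
    {g : GaugeConfig d L (Matrix.specialUnitaryGroup (Fin 2) ℂ) → ((Edge d L × Fin 3) → ℝ)} (hg : Measurable g) (n : ℕ) :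
    ∃ layers : List ((GaugeConfig d L (Matrix.specialUnitaryGroup (Fin 2) ℂ) ≃ᵐ GaugeConfig d L (Matrix.specialUnitaryGroup (Fin 2) ℂ)) × (GaugeConfig d L (Matrix.specialUnitaryGroup (Fin 2) ℂ) → ℝ)),
      layers.map (fun Ly => ((Ly.1 : GaugeConfig d L (Matrix.specialUnitaryGroup (Fin 2) ℂ) → GaugeConfig d L (Matrix.specialUnitaryGroup (Fin 2) ℂ)), Ly.2)) =
        sched.map (fun s =>
          ((fun (V : GaugeConfig d L (Matrix.specialUnitaryGroup (Fin 2) ℂ)) (e : Edge d L) =>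
            if P s e then gaussUnit (geodesicKick (εf s) (Jf s V e)
              (vecQuat ((V e : Matrix.specialUnitaryGroup (Fin 2) ℂ) : Matrix (Fin 2) (Fin 2) ℂ)))
            else V e),
           fun V : GaugeConfig d L (Matrix.specialUnitaryGroup (Fin 2) ℂ) => ∏ a : {e : Edge d L // P s e},
            (if Real.sin (angle (Jf s V a.1) (vecQuat ((V a.1 : Matrix.specialUnitaryGroup (Fin 2) ℂ) : Matrix (Fin 2) (Fin 2) ℂ))) = 0 then
                (1 - εf s * ‖Jf s V a.1‖ * Real.cos (angle (Jf s V a.1) (vecQuat ((V a.1 : Matrix.specialUnitaryGroup (Fin 2) ℂ) : Matrix (Fin 2) (Fin 2) ℂ)))) ^ 3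
              else kickJac (εf s * ‖Jf s V a.1‖) 2 (angle (Jf s V a.1) (vecQuat ((V a.1 : Matrix.specialUnitaryGroup (Fin 2) ℂ) : Matrix (Fin 2) (Fin 2) ℂ)))))) ∧
      IsReversible
        (conjKernel
          (refreshUpdate
            (involMH
              (⇑((flip : Equiv.Perm (GaugeConfig d L (Matrix.specialUnitaryGroup (Fin 2) ℂ) × ((Edge d L × Fin 3) → ℝ))) *
                  leapfrog (mulDrift fun q : (Edge d L × Fin 3) → ℝ =>
                    fun ℓ : Edge d L => gaussUnit (toLp 2
          ![Real.cos (c * Real.sqrt (q (ℓ, 0) ^ 2 + q (ℓ, 1) ^ 2 + q (ℓ, 2) ^ 2)),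
            c * Real.sinc (c * Real.sqrt (q (ℓ, 0) ^ 2 + q (ℓ, 1) ^ 2 + q (ℓ, 2) ^ 2)) * q (ℓ, 0),
            c * Real.sinc (c * Real.sqrt (q (ℓ, 0) ^ 2 + q (ℓ, 1) ^ 2 + q (ℓ, 2) ^ 2)) * q (ℓ, 1),
            c * Real.sinc (c * Real.sqrt (q (ℓ, 0) ^ 2 + q (ℓ, 1) ^ 2 + q (ℓ, 2) ^ 2)) * q (ℓ, 2)])) g ^ n))
              (measurable_flip_leapfrog_pow (measurable_mulDrift (measurable_su2Drift c)) hg n)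
              fun z : GaugeConfig d L (Matrix.specialUnitaryGroup (Fin 2) ℂ) × ((Edge d L × Fin 3) → ℝ) =>
                (S ((layers.foldr (fun Ly (G : GaugeConfig d L (Matrix.specialUnitaryGroup (Fin 2) ℂ) ≃ᵐ GaugeConfig d L (Matrix.specialUnitaryGroup (Fin 2) ℂ)) => Ly.1.trans G)
              (MeasurableEquiv.refl (GaugeConfig d L (Matrix.specialUnitaryGroup (Fin 2) ℂ)))) z.1) - Real.log ((layers.foldr (fun Ly K => fun V => Ly.2 V * K (Ly.1 V)) (fun _ => (1 : ℝ))) z.1)) + ∑ i, z.2 i ^ 2 / 2)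
            ((((volume : Measure ((Edge d L × Fin 3) → ℝ)).withDensity
                  fun q => ENNReal.ofReal (Real.exp (-(∑ i, q i ^ 2 / 2)))) Set.univ)⁻¹ •
              (volume : Measure ((Edge d L × Fin 3) → ℝ)).withDensity
                fun q => ENNReal.ofReal (Real.exp (-(∑ i, q i ^ 2 / 2)))))
          (layers.foldr (fun Ly (G : GaugeConfig d L (Matrix.specialUnitaryGroup (Fin 2) ℂ) ≃ᵐ GaugeConfig d L (Matrix.specialUnitaryGroup (Fin 2) ℂ)) => Ly.1.trans G)
              (MeasurableEquiv.refl (GaugeConfig d L (Matrix.specialUnitaryGroup (Fin 2) ℂ)))))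
        ((Measure.pi fun _ : Edge d L => haarProbability (Matrix.specialUnitaryGroup (Fin 2) ℂ)).withDensity
          fun U => ENNReal.ofReal (Real.exp (-S U))) := by
  obtain ⟨layers, hmap, hpos, hmeas, hjac⟩ := exists_layers_su2MaskedKick P εf Jf hJm hJloc hκ sched
  obtain ⟨h0, hm, hJ⟩ := hasJacobian_foldr_trans layers hpos hmeas hjac
  haveI := isNegInvariant_volume_pi (Λ := Edge d L × Fin 3)
  refine ⟨layers, hmap, ?_⟩
  exact gauge_fthmc_leapfrog_config_isReversible
    (μ := Measure.pi fun _ : Edge d L => haarProbability (Matrix.specialUnitaryGroup (Fin 2) ℂ))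
    (ν := (volume : Measure ((Edge d L × Fin 3) → ℝ)))
    (F := (layers.foldr (fun Ly (G : GaugeConfig d L (Matrix.specialUnitaryGroup (Fin 2) ℂ) ≃ᵐ GaugeConfig d L (Matrix.specialUnitaryGroup (Fin 2) ℂ)) => Ly.1.trans G)
              (MeasurableEquiv.refl (GaugeConfig d L (Matrix.specialUnitaryGroup (Fin 2) ℂ)))))
    (J := (layers.foldr (fun Ly K => fun V => Ly.2 V * K (Ly.1 V)) (fun _ => (1 : ℝ))))
    (e := fun q : (Edge d L × Fin 3) → ℝ => fun ℓ : Edge d L => gaussUnit (toLp 2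
          ![Real.cos (c * Real.sqrt (q (ℓ, 0) ^ 2 + q (ℓ, 1) ^ 2 + q (ℓ, 2) ^ 2)),
            c * Real.sinc (c * Real.sqrt (q (ℓ, 0) ^ 2 + q (ℓ, 1) ^ 2 + q (ℓ, 2) ^ 2)) * q (ℓ, 0),
            c * Real.sinc (c * Real.sqrt (q (ℓ, 0) ^ 2 + q (ℓ, 1) ^ 2 + q (ℓ, 2) ^ 2)) * q (ℓ, 1),
            c * Real.sinc (c * Real.sqrt (q (ℓ, 0) ^ 2 + q (ℓ, 1) ^ 2 + q (ℓ, 2) ^ 2)) * q (ℓ, 2)]))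
    (g := g) (S := S) (T := fun q : (Edge d L × Fin 3) → ℝ => ∑ i, q i ^ 2 / 2)
    h0 hm hJ (fun q => su2Drift_neg c q) (measurable_su2Drift c) hg n hS
    measurable_piGaussianKinetic

/-- **… and has `⟨e^{−ΔH̃}⟩ = 1` in equilibrium** (`e^{−S}` integrable). -/
theorem su2_fthmc_leapfrog_gaussian_creutz_maskedKickSchedule (εf : σ → ℝ)
    (Jf : σ → GaugeConfig d L (Matrix.specialUnitaryGroup (Fin 2) ℂ) → Edge d L → R4)
    (hJm : ∀ s e, P s e → Measurable fun V : GaugeConfig d L (Matrix.specialUnitaryGroup (Fin 2) ℂ) => Jf s V e)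
    (hJloc : ∀ s (V W : GaugeConfig d L (Matrix.specialUnitaryGroup (Fin 2) ℂ)),
      (∀ j, ¬P s j → V j = W j) → ∀ e, P s e → Jf s V e = Jf s W e)
    (hκ : ∀ s (V : GaugeConfig d L (Matrix.specialUnitaryGroup (Fin 2) ℂ)) (e : Edge d L),
      P s e → |εf s| * ‖Jf s V e‖ < 1)
    (sched : List σ)
    {S : GaugeConfig d L (Matrix.specialUnitaryGroup (Fin 2) ℂ) → ℝ} (hS : Measurable S)
    (hSi : Integrable (fun V => Real.exp (-S V))
      (Measure.pi fun _ : Edge d L => haarProbability (Matrix.specialUnitaryGroup (Fin 2) ℂ)))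
    (c : ℝ) {g : GaugeConfig d L (Matrix.specialUnitaryGroup (Fin 2) ℂ) → ((Edge d L × Fin 3) → ℝ)} (hg : Measurable g) (n : ℕ) :
    ∃ layers : List ((GaugeConfig d L (Matrix.specialUnitaryGroup (Fin 2) ℂ) ≃ᵐ GaugeConfig d L (Matrix.specialUnitaryGroup (Fin 2) ℂ)) × (GaugeConfig d L (Matrix.specialUnitaryGroup (Fin 2) ℂ) → ℝ)),
      layers.map (fun Ly => ((Ly.1 : GaugeConfig d L (Matrix.specialUnitaryGroup (Fin 2) ℂ) → GaugeConfig d L (Matrix.specialUnitaryGroup (Fin 2) ℂ)), Ly.2)) =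
        sched.map (fun s =>
          ((fun (V : GaugeConfig d L (Matrix.specialUnitaryGroup (Fin 2) ℂ)) (e : Edge d L) =>
            if P s e then gaussUnit (geodesicKick (εf s) (Jf s V e)
              (vecQuat ((V e : Matrix.specialUnitaryGroup (Fin 2) ℂ) : Matrix (Fin 2) (Fin 2) ℂ)))
            else V e),
           fun V : GaugeConfig d L (Matrix.specialUnitaryGroup (Fin 2) ℂ) => ∏ a : {e : Edge d L // P s e},
            (if Real.sin (angle (Jf s V a.1) (vecQuat ((V a.1 : Matrix.specialUnitaryGroup (Fin 2) ℂ) : Matrix (Fin 2) (Fin 2) ℂ))) = 0 then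
                (1 - εf s * ‖Jf s V a.1‖ * Real.cos (angle (Jf s V a.1) (vecQuat ((V a.1 : Matrix.specialUnitaryGroup (Fin 2) ℂ) : Matrix (Fin 2) (Fin 2) ℂ)))) ^ 3
              else kickJac (εf s * ‖Jf s V a.1‖) 2 (angle (Jf s V a.1) (vecQuat ((V a.1 : Matrix.specialUnitaryGroup (Fin 2) ℂ) : Matrix (Fin 2) (Fin 2) ℂ)))))) ∧
      ∫ z, Real.exp (-(((S ((⇑(layers.foldr (fun Ly (G : GaugeConfig d L (Matrix.specialUnitaryGroup (Fin 2) ℂ) ≃ᵐ GaugeConfig d L (Matrix.specialUnitaryGroup (Fin 2) ℂ)) => Ly.1.trans G)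
              (MeasurableEquiv.refl (GaugeConfig d L (Matrix.specialUnitaryGroup (Fin 2) ℂ))))) ((((flip : Equiv.Perm (GaugeConfig d L (Matrix.specialUnitaryGroup (Fin 2) ℂ) × ((Edge d L × Fin 3) → ℝ))) *
              leapfrog (mulDrift (fun q : ((Edge d L × Fin 3) → ℝ) => fun ℓ : Edge d L => gaussUnit (toLp 2
          ![Real.cos (c * Real.sqrt (q (ℓ, 0) ^ 2 + q (ℓ, 1) ^ 2 + q (ℓ, 2) ^ 2)),
            c * Real.sinc (c * Real.sqrt (q (ℓ, 0) ^ 2 + q (ℓ, 1) ^ 2 + q (ℓ, 2) ^ 2)) * q (ℓ, 0),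
            c * Real.sinc (c * Real.sqrt (q (ℓ, 0) ^ 2 + q (ℓ, 1) ^ 2 + q (ℓ, 2) ^ 2)) * q (ℓ, 1),
            c * Real.sinc (c * Real.sqrt (q (ℓ, 0) ^ 2 + q (ℓ, 1) ^ 2 + q (ℓ, 2) ^ 2)) * q (ℓ, 2)]))) g ^ n)) z).1) -
            Real.log ((layers.foldr (fun Ly K => fun V => Ly.2 V * K (Ly.1 V)) (fun _ => (1 : ℝ))) ((((flip : Equiv.Perm (GaugeConfig d L (Matrix.specialUnitaryGroup (Fin 2) ℂ) × ((Edge d L × Fin 3) → ℝ))) *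
              leapfrog (mulDrift (fun q : ((Edge d L × Fin 3) → ℝ) => fun ℓ : Edge d L => gaussUnit (toLp 2
          ![Real.cos (c * Real.sqrt (q (ℓ, 0) ^ 2 + q (ℓ, 1) ^ 2 + q (ℓ, 2) ^ 2)),
            c * Real.sinc (c * Real.sqrt (q (ℓ, 0) ^ 2 + q (ℓ, 1) ^ 2 + q (ℓ, 2) ^ 2)) * q (ℓ, 0),
            c * Real.sinc (c * Real.sqrt (q (ℓ, 0) ^ 2 + q (ℓ, 1) ^ 2 + q (ℓ, 2) ^ 2)) * q (ℓ, 1),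
            c * Real.sinc (c * Real.sqrt (q (ℓ, 0) ^ 2 + q (ℓ, 1) ^ 2 + q (ℓ, 2) ^ 2)) * q (ℓ, 2)]))) g ^ n)) z).1)) +
            ∑ i, ((((flip : Equiv.Perm (GaugeConfig d L (Matrix.specialUnitaryGroup (Fin 2) ℂ) × ((Edge d L × Fin 3) → ℝ))) *
              leapfrog (mulDrift (fun q : ((Edge d L × Fin 3) → ℝ) => fun ℓ : Edge d L => gaussUnit (toLp 2
          ![Real.cos (c * Real.sqrt (q (ℓ, 0) ^ 2 + q (ℓ, 1) ^ 2 + q (ℓ, 2) ^ 2)),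
            c * Real.sinc (c * Real.sqrt (q (ℓ, 0) ^ 2 + q (ℓ, 1) ^ 2 + q (ℓ, 2) ^ 2)) * q (ℓ, 0),
            c * Real.sinc (c * Real.sqrt (q (ℓ, 0) ^ 2 + q (ℓ, 1) ^ 2 + q (ℓ, 2) ^ 2)) * q (ℓ, 1),
            c * Real.sinc (c * Real.sqrt (q (ℓ, 0) ^ 2 + q (ℓ, 1) ^ 2 + q (ℓ, 2) ^ 2)) * q (ℓ, 2)]))) g ^ n)) z).2 i ^ 2 / 2) -
          ((S ((⇑(layers.foldr (fun Ly (G : GaugeConfig d L (Matrix.specialUnitaryGroup (Fin 2) ℂ) ≃ᵐ GaugeConfig d L (Matrix.specialUnitaryGroup (Fin 2) ℂ)) => Ly.1.trans G)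
              (MeasurableEquiv.refl (GaugeConfig d L (Matrix.specialUnitaryGroup (Fin 2) ℂ))))) z.1) - Real.log ((layers.foldr (fun Ly K => fun V => Ly.2 V * K (Ly.1 V)) (fun _ => (1 : ℝ))) z.1)) + ∑ i, z.2 i ^ 2 / 2)))
      ∂(boltzmann ((Measure.pi fun _ : Edge d L => haarProbability (Matrix.specialUnitaryGroup (Fin 2) ℂ)).prod
            (volume : Measure ((Edge d L × Fin 3) → ℝ)))
          fun z : GaugeConfig d L (Matrix.specialUnitaryGroup (Fin 2) ℂ) × ((Edge d L × Fin 3) → ℝ) =>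
            (S ((⇑(layers.foldr (fun Ly (G : GaugeConfig d L (Matrix.specialUnitaryGroup (Fin 2) ℂ) ≃ᵐ GaugeConfig d L (Matrix.specialUnitaryGroup (Fin 2) ℂ)) => Ly.1.trans G)
              (MeasurableEquiv.refl (GaugeConfig d L (Matrix.specialUnitaryGroup (Fin 2) ℂ))))) z.1) - Real.log ((layers.foldr (fun Ly K => fun V => Ly.2 V * K (Ly.1 V)) (fun _ => (1 : ℝ))) z.1)) + ∑ i, z.2 i ^ 2 / 2) = 1 := by
  obtain ⟨layers, hmap, hpos, hmeas, hjac⟩ := exists_layers_su2MaskedKick P εf Jf hJm hJloc hκ sched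
  obtain ⟨h0, hm, hJ⟩ := hasJacobian_foldr_trans layers hpos hmeas hjac
  exact ⟨layers, hmap, gauge_fthmc_leapfrog_gaussian_creutz h0 hm hJ (measurable_su2Drift c) hg n hS hSi⟩

end Schedule

end Summit.Ventures.LatticeQCDFlow.Exactness
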